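import Summits.QuantumAdvantage.AdviceFreeQNC0.WalkPhaseLaw
import Summits.QuantumAdvantage.QuantumAdvantage.Theorems.RingFrameRingToElimFailFloor
import HarnessLib

/-!
# Route RingFrame, crux α `RingToElim` (stmt-QuantumAdvantage-19119): the RING EXACT LAW, sharp
# for every cycle length — no exact polynomial resolvent of degree `≤ ⌊(N−3)/2⌋` on the `N`-cycle

Support theorem for the crux item α in the language of the rung leaf `RingHard 2`
(`Literature…RingHLF.Rel`): the first rung `RingExactLowerBound` of the ring route in its final,
all-`N` form.  `RingFrameRingToElimFailFloor.lean` (`ringExactLowerBound_all`, from the FULL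
exact law) reached degree `(N−4)/2`, sharp for even `N`; the odd lengths `N = 2D+3` need the RING
PHASE LAW of `AdviceFreeQNC0/WalkPhaseLaw.lean` (`ringWinU_exists_fail_ring`: on `2D+2` walk bits
the ring's own charge `n+2` is never the easy charge `−(D+1) (mod 3)`), transported through the
affine chart of `WalkTransport.lean` (`rel_iff_ringWinU`, `xOfU_uVec`, `hasDeg_transport`):

* `exists_odd_uVec_eq` — the chart `uVec` maps the odd class of `{0,1}^{n+1}` ONTO the walk cube
  `{0,1}ⁿ` (injective on the odd class, whose complement has `≤ 2ⁿ` patterns);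
* `ringRel_exists_fail_odd` — `N = 2D+3`, `D ≥ 1`: every tuple of `𝔽₂`-polynomials of degree
  `≤ D` on the `N`-cycle violates `Rel x (P x)` at some pattern `x`;
* `ringRel_exists_fail` — the same for every `N = n+1` with `n ≥ 2D+2` (phase law at `n = 2D+2`,
  fail floor above);
* **`ringExactLowerBound_sharp`** — for EVERY `N ≥ 5`, a map `F` with `Rel x (F x)` for all
  `x ∈ {0,1}^N` has an output bit of `𝔽₂`-degree `> ⌊(N−3)/2⌋`.  This one structural theorem
  subsumes all the dual certificates `noExactResolvent_5_1, _6_1, _7_2, …, _12_4`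
  (`ExactResolventCertificates*.lean`, `native_decide`, `N ≤ 12`) and is sharp by the observed
  threshold `⌊(N−1)/2⌋` of perfect play (kit j241061/j242437, `N ≤ 13`).

The cell's statement (planner qa-qnc0-p1 TARGET §15.3 `RingExactLawU`; prover qn-prover-3 gen 6
kernel proof); a special case / instrument for crux α of route RingFrame; not in print.  WHAT THIS
IS NOT: an exact-law statement (one failing pattern per device), not a constant-loss bound
(`RingHard 2` / α untouched); no separation claim.
-/

-- the sub-problem namespace `Summit.QuantumAdvantage.QuantumAdvantage` repeats the summit name by design (D-0017)
set_option linter.dupNamespace false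

noncomputable section

namespace Summit.QuantumAdvantage.QuantumAdvantage.Theorems

open Finset Summit.QuantumAdvantage.AdviceFreeQNC0
open Literature.Computability.QuantumComplexity Literature.Computability.QuantumComplexity.RingHLF
open Literature.Computability.MetaComplexity Literature.Computability.MetaComplexity.Smolensky

/-- **The chart is onto**: every point of the walk cube `{0,1}ⁿ` (`n ≥ 2`) is `uVec x` for a
pattern `x ∈ {0,1}^{n+1}` of the odd class. -/
theorem exists_odd_uVec_eq {n : ℕ} (hn : 2 ≤ n) (u : Fin n → Bool) :
    ∃ x : Fin (n + 1) → Bool,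
      (univ.filter fun j : Fin (n + 1) => x j = false).card % 2 = 1 ∧ uVec x = u := by
  classical
  set Odd : Finset (Fin (n + 1) → Bool) := univ.filter fun x : Fin (n + 1) → Bool =>
    (univ.filter fun j : Fin (n + 1) => x j = false).card % 2 = 1 with hOdd
  have hinj : Set.InjOn uVec (Odd : Set (Fin (n + 1) → Bool)) := by
    intro x₁ hx₁ x₂ hx₂ h
    rw [Finset.mem_coe, hOdd, mem_filter] at hx₁ hx₂
    rw [← xOfU_uVec hn x₁ hx₁.2, ← xOfU_uVec hn x₂ hx₂.2, h]
  have hOddcard : 2 ^ n ≤ Odd.card := by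
    have htot : Odd.card + (univ.filter fun x : Fin (n + 1) → Bool =>
        ¬ (univ.filter fun j : Fin (n + 1) => x j = false).card % 2 = 1).card = 2 ^ (n + 1) := by
      rw [hOdd, Finset.card_filter_add_card_filter_not, Finset.card_univ, Fintype.card_fun,
        Fintype.card_bool, Fintype.card_fin]
    have heven := (card_even_class_le (n := n))
    have h2 : 2 ^ (n + 1) = 2 ^ n + 2 ^ n := by ring
    omega
  have himage : Odd.image uVec = univ := by
    apply Finset.eq_univ_of_card
    rw [Finset.card_image_of_injOn hinj, Fintype.card_fun, Fintype.card_bool, Fintype.card_fin]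
    refine le_antisymm ?_ hOddcard
    calc Odd.card = (Odd.image uVec).card := (Finset.card_image_of_injOn hinj).symm
      _ ≤ (univ : Finset (Fin n → Bool)).card := Finset.card_le_univ _
      _ = 2 ^ n := by rw [Finset.card_univ, Fintype.card_fun, Fintype.card_bool, Fintype.card_fin]
  have hmem : u ∈ Odd.image uVec := by rw [himage]; exact Finset.mem_univ _
  obtain ⟨x, hx, hxu⟩ := Finset.mem_image.1 hmem
  exact ⟨x, (Finset.mem_filter.1 hx).2, hxu⟩

/-- **THE PHASE LAW ON THE RING** (odd length `N = 2D+3`, `D ≥ 1`): every tuple `P` of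
`𝔽₂`-polynomials of degree `≤ D` on the patterns of the `(2D+3)`-cycle violates `Rel x (P x)` at
some pattern `x`. [folklore] -/
theorem ringRel_exists_fail_odd (D : ℕ) (hD : 1 ≤ D)
    (P : Fin (2 * D + 2 + 1) → CubeFn (ZMod 2) (2 * D + 2 + 1))
    (hP : ∀ i, P i ∈ lowDeg (ZMod 2) (2 * D + 2 + 1) D) :
    ∃ x : Fin (2 * D + 2 + 1) → Bool, ¬ Rel x (fun i => decide (P i x = 1)) := by
  classical
  set z : (Fin (2 * D + 2 + 1) → Bool) → (Fin (2 * D + 2 + 1) → Bool) :=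
    fun x i => decide (P i x = 1) with hz
  set y : Fin (2 * D + 2 + 1) → (Fin (2 * D + 2) → Bool) → Bool :=
    fun g u => xor (z (xOfU u) g) (tGuess (xOfU u) g) with hy
  have hdeg : ∀ g, HasDeg (y g) D := fun g => hasDeg_transport hD (P g) (hP g) g
  obtain ⟨u, hu⟩ := ringWinU_exists_fail_ring D y hdeg
  obtain ⟨x, hodd, rfl⟩ := exists_odd_uVec_eq (n := 2 * D + 2) (by omega) u
  refine ⟨x, fun hrel => ?_⟩
  have hwin := (rel_iff_ringWinU (n := 2 * D + 2) (by omega) x hodd z).1 hrel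
  rw [hwin] at hu
  exact Bool.noConfusion hu

/-- **No perfect polynomial device of degree `D` on the `(n+1)`-cycle for any `n ≥ 2D+2`**
(`D ≥ 1`): the phase law at `n = 2D+2`, the fail floor `ringRel_fail_floor` above. [folklore] -/
theorem ringRel_exists_fail (D : ℕ) (hD : 1 ≤ D) {n : ℕ} (hn : 2 * D + 2 ≤ n)
    (P : Fin (n + 1) → CubeFn (ZMod 2) (n + 1)) (hP : ∀ i, P i ∈ lowDeg (ZMod 2) (n + 1) D) :
    ∃ x : Fin (n + 1) → Bool, ¬ Rel x (fun i => decide (P i x = 1)) := by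
  classical
  by_cases h : n = 2 * D + 2
  · subst h
    exact ringRel_exists_fail_odd D hD P hP
  · have hn' : 2 * D + 3 ≤ n := by omega
    have hfl := ringRel_fail_floor D hD hn' P hP
    have hpos : 0 < (univ.filter fun x : Fin (n + 1) → Bool =>
        ¬ Rel x (fun i => decide (P i x = 1))).card :=
      lt_of_lt_of_le (Nat.two_pow_pos _) hfl
    obtain ⟨x, hx⟩ := Finset.card_pos.1 hpos
    exact ⟨x, (Finset.mem_filter.1 hx).2⟩

/-- **THE RING EXACT LAW, SHARP FOR EVERY LENGTH** (the all-`N` form of the route's first rung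
`RingExactLowerBound`; subsumes the certificates `noExactResolvent_5_1 … _12_4`): for `N ≥ 5`, a
map `F` with `Rel x (F x)` for EVERY pattern `x ∈ {0,1}^N` has some output bit of `𝔽₂`-degree
`> ⌊(N − 3)/2⌋`. [folklore] -/
theorem ringExactLowerBound_sharp {N : ℕ} (hN : 5 ≤ N) (F : (Fin N → Bool) → (Fin N → Bool))
    (hF : ∀ x, Rel x (F x)) :
    ∃ k : Fin N, (fun x => if F x k then (1 : ZMod 2) else 0) ∉ lowDeg (ZMod 2) N ((N - 3) / 2) := by
  classical
  obtain ⟨n, rfl⟩ : ∃ n, N = n + 1 := ⟨N - 1, by omega⟩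
  by_contra hall
  simp only [not_exists, not_not] at hall
  set D := (n + 1 - 3) / 2 with hDdef
  have hD : 1 ≤ D := by omega
  have hn : 2 * D + 2 ≤ n := by omega
  obtain ⟨x, hx⟩ := ringRel_exists_fail D hD hn (fun k x => if F x k then (1 : ZMod 2) else 0) hall
  have hz : (fun i => decide ((if F x i then (1 : ZMod 2) else 0) = 1)) = F x := by
    funext i; cases F x i <;> simp
  rw [hz] at hx
  exact hx (hF x)

end Summit.QuantumAdvantage.QuantumAdvantage.Theorems

end
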